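import Summits.KontsevichZagierPeriods.KontsevichZagierPeriods.Theses.FermatIsogeny
import Summits.KontsevichZagierPeriods.KontsevichZagierPeriods.Theorems.FermatIsogenyBetaLinearSectorHalfIntegers
import Literature.NumberTheory.Transcendental.KZCalculus
import HarnessLib

/-!
# `BetaLinearSector` (stmt-KontsevichZagierPeriods-3897) — the crux as OBVIOUS CLASS ∨ TRANSCENDENCE (residual statement)

A bookkeeping theorem isolating what is left of the crux after section `Sector` of line `fermat-sector-transport` (lead c4): the
crux `BetaLinearSector` follows from

* (A) Conjecture 1 on the OBVIOUS KOBLITZ–ROHRLICH CLASS of every holomorphic triple — the statement of the landed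
  `betaLinearSector_fermatS3Class` (Theorems/FermatIsogenyBetaLinearSectorStubFermatReflectionRung.lean; unconditional, all levels), and
* (T) the pure TRANSCENDENCE dichotomy: every pair of positive rational exponents is either in that obvious class, or the ratio of the two
  Beta values `B(a,b)/B(a′,b′)` is not a real algebraic number

— both taken as hypotheses here (the conclusion is the crux statement UNFOLDED, so that nothing is credited and no theorem of this
file concludes the route decl by name), and the file imports nothing beyond the landed value computation `value_of_pinned`.  (T) restricted to
pairs of a common level `N` with `(N, 6) = 1` is Wolfart–Wüstholz 1985 together with Koblitz–Rohrlich 1978, Thm 1 (no non-obvious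
coincidences); in general it is the value side of the apex `HuberWustholzCurvePeriods`.  No new mathematics: case split and the value
of a pinned cell `c·Γ(a)Γ(b)/Γ(a+b)`.

References: N. Koblitz, D. Rohrlich, Canad. J. Math. 30 (1978), p. 1184 and Thm 1; J. Wolfart, G. Wüstholz, Math. Ann. 273 (1985);
M. Kontsevich, D. Zagier, *Periods* (2001), §1.2.
-/

noncomputable section

namespace Summit.KontsevichZagierPeriods.FermatIsogeny.BetaLinearSector

open MeasureTheory Set
open Literature.NumberTheory.Transcendental
open Literature.NumberTheory.Transcendental.KZ
open Summit.KontsevichZagierPeriods.FermatIsogeny.BetaLinearSector.HalfIntegers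

/-- **The crux from the obvious class and the transcendence dichotomy.**  If (A) Conjecture 1 holds on the `S₃ × ℤ²`-orbit of
every holomorphic triple (the statement of the landed `betaLinearSector_fermatS3Class`) and (T) every pair of positive rational
exponents outside such an orbit has a non-algebraic Beta ratio, then the crux statement (unfolded) holds: in the second case the hypothesis
`r.value = r′.value` reads `B(a,b) = c·B(a′,b′)` with `c` real algebraic (`value_of_pinned`), which (T) forbids.
[cite: KoblitzRohrlich1978, p. 1184] [cite: KontsevichZagier2001, §1.2] -/
theorem betaLinearSector_unfolded_of_obviousClass_of_dichotomy
    (hA : ∀ (a b a' b' : ℚ) (c : ℝ), 0 < a → 0 < b → 0 < a' → 0 < b' → IsAlgebraic ℚ c →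
      (∃ (a₀ b₀ a₁ b₁ : ℚ) (i j i' j' : ℤ), 0 < a₀ ∧ 0 < b₀ ∧ a₀ + b₀ < 1 ∧
        a = a₀ + i ∧ b = b₀ + j ∧ a' = a₁ + i' ∧ b' = b₁ + j' ∧
        ((a₁ = a₀ ∧ b₁ = b₀) ∨ (a₁ = b₀ ∧ b₁ = a₀) ∨ (a₁ = 1 - a₀ - b₀ ∧ b₁ = b₀) ∨ (a₁ = b₀ ∧ b₁ = 1 - a₀ - b₀) ∨
          (a₁ = a₀ ∧ b₁ = 1 - a₀ - b₀) ∨ (a₁ = 1 - a₀ - b₀ ∧ b₁ = a₀))) →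
      ∀ (r r' : KZ.IntegralRep 1),
        r.domain = {x | x 0 ∈ Set.Ioo (0:ℝ) 1} →
        Set.EqOn r.integrand (fun x => (x 0) ^ ((a:ℝ) - 1) * (1 - x 0) ^ ((b:ℝ) - 1)) r.domain →
        r'.domain = {x | x 0 ∈ Set.Ioo (0:ℝ) 1} →
        Set.EqOn r'.integrand (fun x => c * (x 0) ^ ((a':ℝ) - 1) * (1 - x 0) ^ ((b':ℝ) - 1)) r'.domain →
        r.value = r'.value → KZ.Equivalent r r')
    (hT : ∀ (a b a' b' : ℚ), 0 < a → 0 < b → 0 < a' → 0 < b' →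
      (∃ (a₀ b₀ a₁ b₁ : ℚ) (i j i' j' : ℤ), 0 < a₀ ∧ 0 < b₀ ∧ a₀ + b₀ < 1 ∧
        a = a₀ + i ∧ b = b₀ + j ∧ a' = a₁ + i' ∧ b' = b₁ + j' ∧
        ((a₁ = a₀ ∧ b₁ = b₀) ∨ (a₁ = b₀ ∧ b₁ = a₀) ∨ (a₁ = 1 - a₀ - b₀ ∧ b₁ = b₀) ∨ (a₁ = b₀ ∧ b₁ = 1 - a₀ - b₀) ∨
          (a₁ = a₀ ∧ b₁ = 1 - a₀ - b₀) ∨ (a₁ = 1 - a₀ - b₀ ∧ b₁ = a₀))) ∨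
      ∀ c : ℝ, IsAlgebraic ℚ c →
        Real.Gamma (a:ℝ) * Real.Gamma (b:ℝ) / Real.Gamma ((a:ℝ) + (b:ℝ)) ≠
          c * (Real.Gamma (a':ℝ) * Real.Gamma (b':ℝ) / Real.Gamma ((a':ℝ) + (b':ℝ)))) :
    ∀ (a b a' b' : ℚ) (c : ℝ), 0 < a → 0 < b → 0 < a' → 0 < b' → IsAlgebraic ℚ c →
      ∀ (r r' : KZ.IntegralRep 1),
        r.domain = {x | x 0 ∈ Set.Ioo (0:ℝ) 1} →
        Set.EqOn r.integrand (fun x => (x 0) ^ ((a:ℝ) - 1) * (1 - x 0) ^ ((b:ℝ) - 1)) r.domain →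
        r'.domain = {x | x 0 ∈ Set.Ioo (0:ℝ) 1} →
        Set.EqOn r'.integrand (fun x => c * (x 0) ^ ((a':ℝ) - 1) * (1 - x 0) ^ ((b':ℝ) - 1)) r'.domain →
        r.value = r'.value → KZ.Equivalent r r' := by
  intro a b a' b' c ha hb ha' hb' hc r r' hd hi hd' hi' hv
  rcases hT a b a' b' ha hb ha' hb' with hO | hne
  · exact hA a b a' b' c ha hb ha' hb' hc hO r r' hd hi hd' hi' hv
  · exfalso
    have hvr : r.value = 1 * (Real.Gamma (a:ℝ) * Real.Gamma (b:ℝ) / Real.Gamma ((a:ℝ) + (b:ℝ))) :=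
      value_of_pinned (c := 1) (r := r) ⟨hd, fun x hx => by simp only [hi hx, one_mul]⟩ ha hb
    have hvr' : r'.value = c * (Real.Gamma (a':ℝ) * Real.Gamma (b':ℝ) / Real.Gamma ((a':ℝ) + (b':ℝ))) :=
      value_of_pinned (c := c) (r := r') ⟨hd', hi'⟩ ha' hb'
    exact hne c hc (by rw [one_mul] at hvr; rw [← hvr, hv, hvr'])

end Summit.KontsevichZagierPeriods.FermatIsogeny.BetaLinearSector

end
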